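import Summits.QuantumFields.YangMills.Theorems.UnitScaleTiltProp7LaplaceAFlatLetters
import Summits.QuantumFields.YangMills.Theorems.UnitScaleTiltProp7FlatCoercivityR
import HarnessLib

/-!
# Route `UnitScaleTilt`, crux «MinimiserStabilityRegPr» (stmt-QuantumFields-19200), route-R E′ architecture (A′) «HCOW-VIA-Σ» (★★OWNER RULING g28-№13) —
# THE (c3) FLAT CERTIFICATE OF THE DISPLAYED COERCIVITY ROW, SEAM S4 «THE PROJECTOR SEAM»: at the trivial background the member's gauge projector
# `R_S(1)` (brick L0c `Prop7SectET3GaugeProjector.RS … 1` = the orthogonal projection onto `Δ^η_1 N_S(1)`, `N_S(1) = ker (Q(1) ∘ D_1)`, in the weighted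
# space `SiteL2K ℂ 3 (periodsT3 F K) c₀ W₂`) DOMINATES, ENTRY BY ENTRY, lit-balaban's one-level residual projection `R = B6SectAOperatorsV1.RE (twoScale (K−n) _ ∅)`
# of [Balaban1984PropagatorsII] (2.10)–(2.12) — the letter in which ✓`Prop7FlatCoercivityR.flat_coercive_R_T3` is written:
# `c₀ · Σ_{ii′} (‖R (Re λ_{ii′})‖² + ‖R (Im λ_{ii′})‖²) ≤ ‖R_S(1) (toL2S λ)‖²`, and at `λ := D*_1 X`:
# `c₀ · Σ_{ii′} (‖R ∂*(Re X_{ii′})‖² + ‖R ∂*(Im X_{ii′})‖²) ≤ ‖R_S(1) (D*_1 (toL2 X))‖²`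

Cell `ym3-torus` (HUMAN RULING D-0037, YM ladder rung R3 — YM₃ on T³, NOT d = 4, NOT Clay; YM gap NOT proved), width seat `ym3-torus-px4` g5 (explicit-unit;
`--kind proof --supports stmt-QuantumFields-19200 --as helper`, count-neutral; NO claim on crux ∕ stub ∕ registry).  CO-HAND of width seat `ym3-torus-px6` g5, whose LOCATE
«(c3) A6-FLAT GUARD» (19200 evidence #58, `pub/ym3-torus/ym3-torus-px6/g5/LOCATE-A6FLAT-px6g5.md` §1) lists the five seams S1–S5 of the (c3) certificate («A6 BY KERNEL at the
flat member», RULING g28-№13 (2)(c3), ACK 91 (1)); this file is S4, «the one non-mechanical step» (★p1 g17 WORD 11 (d) GO under px6's lead).  THEOREMS ONLY (0 `def`, 0 `sorry`).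

THE PRINT.  [Balaban1985BackgroundPropagators] p. 394: *«R = R(U) is an orthogonal projection in the Hilbert space L²(Ω₀, 𝔤) onto the subspace ℛ = Δ^η_U N(Q′), N(Q′) = {λ : Q′λ = 0}.
(3.21)»*; p. 418: *«Q_jDλ = D_jQ′_jλ, (3.115) … In particular they imply that the averages QA are invariant with respect to gauge transformations λ satisfying Q′λ = 0»*.
[Balaban1984PropagatorsII] (2.10)–(2.12) p. 225: the flat `R`, *"an orthogonal projection in the space L²(T_η) onto the subspace ΔN(Q′)"*.  [Balaban1984PropagatorsI] (1.20)
p. 20: `Q_kA^λ = Q_kA − ∂Q′_kλ`.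

WHY (located, px6 g5 LOCATE §0 (V1)∕(V3); px12 g5 second read PASS).  At `U₀ = 1` the quadratic form of the member's `Δ_a(1) = laplaceA … 1` splits as
`re⟨y, Δx 1 y⟩ + ‖R_S(1)(D*_1 y)‖² + a‖Q_k(1) y‖²`; the flat engine ✓`flat_coercive_R_T3` is stated for REAL scalar bond fields with lit-balaban's projector `RE` acting on the
real divergence `dsE`.  Reading the engine on the eight real components of `X` produces `Σ_{ii′}(‖R ∂*(Re X_{ii′})‖² + ‖R ∂*(Im X_{ii′})‖²)`; the (c3) assembly needs this sum to be
dominated by the single complex-Hilbert term `‖R_S(1)(D*_1 (toL2 X))‖²`.  Two DIFFERENT formalisations of print's projector meet here: `RS 1 = projR (covLapSite 1) (QL2 1 ∘ DL2 1)`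
(`B11Eq103H1Complex`, fibre `W₂ = ℂ^{2×2}`, intrinsic `N_S`) versus `RE D s = starProjection ((ker Q′).map Δ)` (`B6SectAOperatorsV1`, real scalars, print's `N(Q′)`).  The bridge
is (3.115) in its flat form ✓`B5Eq120IterProof.bondAvgIter_grad` (`Q_k ∂ = ∂ Q′_k`): every `μ ∈ N(Q′)` placed in any matrix entry (real or imaginary part) is a gauge parameter in
`N_S(1)`, so `Δ N(Q′)`, entrywise, sits inside `Δ^η_1 N_S(1)` — an INCLUSION of ranges of orthogonal projections, which is all an inequality of norms needs (§0).  No estimate, no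
analysis, no mean-free cut (the constants `N_S(1) ⊖ N(Q′)^{⊕8}` are killed by `Δ`, exactly as brick L0c's docstring says).

WHAT IS PROVED (member `F : T3Family`, heights `n ≤ K`, weights `c₀ > 0`, `cB`; `s := L^{K−n} = η⁻¹`; `D := twoScale (K−n) (succ_le_T3 F n K) ∅`):
* §0 `norm_sq_le_norm_sq_starProjection_of_mem` — abstract Hilbert row: `m ∈ U`, `‖m‖² = re⟨m, v⟩` ⟹ `‖m‖² ≤ ‖P_U v‖²` [folklore].
* §1 `map_laplace`, `map_grad`, `map_siteAvg`, `map_siteAvgIter` (real-linear maps of the coefficients commute with the flat site operators) and the entrywise `re`∕`im` rows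
  `laplace_entry_re∕im`, `siteAvgIter_entry_re∕im`, `diverg_entry_re'∕im'` (the T³ twins of ✓`K0Stub1FlatHessianLandauCoercivity.diverg_entry_re∕im`, other carrier).
* §2 THE FLAT READINGS of brick L0a's first-order letters: ★`DL2_one_eq_grad` (`(toL2)⁻¹(D_1(toL2S λ)) = grad η⁻¹ λ`), ★`DstarL2_one_eq_diverg` (`(toL2S)⁻¹(D*_1(toL2 X)) = diverg η⁻¹ X`),
  ★`covLapSite_one_eq_laplace` (`(toL2S)⁻¹(Δ^η_1(toL2S λ)) = laplace η⁻¹ λ`) — ✓`Prop7LandauDict.DL2_toL2S_eq_covDerivFwdT`∕`DstarL2_toL2_eq_covDivFormT` at `bgUnits 1 = 1` and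
  lit ✓`T3SectALandauChart.covDerivFwdT_one`∕`covDivFormT_one`.
* §3 `re_inner_toL2S` (the real part of the weighted `L²` pairing of gauge parameters entry by entry; the norm is ✓`Prop7LaplaceAFlatLetters.norm_sq_toL2S`, px6 g5 FILE A), `inv_eta_eq` (`η⁻¹ = L^{K−n}`), `inner_RE_self` (`⟨Rf, f⟩ = ‖Rf‖²`).
* §4 ★★ `mul_sum_norm_sq_RE_entries_le_norm_sq_RS_one` — THE SEAM: `c₀ · Σ_{ii′} (‖RE D s (Re λ_{ii′})‖² + ‖RE D s (Im λ_{ii′})‖²) ≤ ‖RS … 1 (toL2S λ)‖²` for every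
  `λ : Site (F.P K) 0 → M₂(ℂ)`; ★★ `mul_sum_norm_sq_RE_dsE_entries_le_norm_sq_RS_one_DstarL2` — the same at `λ := D*_1 X`, with `dsE s` on the eight real components of `X` on the left
  and `RS … 1 (DstarL2 … 1 (toL2 X))` on the right: the row the (c3) assembly (px6 g5, FILE B) consumes next to ✓`flat_coercive_R_T3`.
HONEST SCOPE.  Flat background only (`U₀ = 1`); linear algebra + index bookkeeping over landed letters; the INEQUALITY (range inclusion) is proved, the equality of the two projectors
up to constants is not needed and not claimed; nothing of [B9] Thm 3.11 ∕ the (COERC) row at a curved background ∕ `hcoW` ∕ E′ ∕ EX ∕ the stubs ∕ the crux is proved here; no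
continuum ∕ OS ∕ mass-gap ∕ Clay statement.  No `sorry`, no `def`, no `instance`, no `notation`; axioms {propext, Classical.choice, Quot.sound}.

References: T. Bałaban, CMP **99** (1985) 389–434 [Balaban1985BackgroundPropagators] ((3.3) p.391, (3.8) p.392, (3.11) p.392, (3.21)–(3.26) pp.394–395, (3.114)–(3.115) p.418);
CMP **96** (1984) 223–250 [Balaban1984PropagatorsII] ((2.7)–(2.12) pp.224–225); CMP **95** (1984) 17–40 [Balaban1984PropagatorsI] ((1.4) p.18, (1.13) p.19, (1.18)–(1.21) pp.20–21,
Prop. 1.1 (1.90) p.33); CMP **102** (1985) 255–275 [Balaban1985UV3] ((1)–(3) p.256).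
-/

set_option autoImplicit false

noncomputable section

open scoped InnerProductSpace ComplexConjugate Matrix.Norms.L2Operator BigOperators

namespace Summit.QuantumFields.YangMills.Theorems.Prop7FlatProjectorSeam

open Literature.MathematicalPhysics.QuantumFieldTheory.Balaban1983to89
open Literature.MathematicalPhysics.QuantumFieldTheory.Balaban1983to89.T3ContinuumYM3Torus
open LatticeFieldCalculus (grad diverg laplace siteAvg siteAvgIter bondAvgIter)
open T3SectALandauChart (eta eta_pos bgUnits bgUnits_one covDerivFwdT_one covDivFormT_one)
open B4Sect5Torus (TSite)
open B9Eq311L2Pairing (WL2)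
open B11Eq103H1Complex (SiteL2K BondL2K projR)
open B6SectAOperatorsV1 (ScalarSpace RE KE QpE dE dsE lapE lapE_apply RE_range RE_apply)
open B6SectCTwoScaleV1 (twoScale)
open B6ProjR212TorusBridge (QpE_twoScale_empty_eq_zero_iff)
open Summit.QuantumFields.YangMills.Theorems.Prop7SectET3Transport (periodsT3 siteEquiv bondEquiv)
open Summit.QuantumFields.YangMills.Theorems.Prop7SectET3HilbertLetters (W₂ frobEquiv frobEquiv_symm_apply_apply toL2 toL2S toL2B toL2S_apply QL2 DL2
  DstarL2 covLapSite QL2_toL2)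
open Summit.QuantumFields.YangMills.Theorems.Prop7SectET3GaugeProjector (QDS NS RS QDS_apply RS_eq_projR)
open Summit.QuantumFields.YangMills.Theorems.Prop7SymAvgTwSym (QTwS QTwS_one_apply)
open Summit.QuantumFields.YangMills.Theorems.Prop7LandauDict (DL2_toL2S_eq_covDerivFwdT DstarL2_toL2_eq_covDivFormT)
open Summit.QuantumFields.YangMills.Theorems.Prop7FlatCoercivityR (succ_le_T3)

/-! ## §0 The abstract Hilbert row: a vector of a closed subspace that pairs with `v` like its own square is shorter than the projection of `v` -/

section Abstract

variable {𝕜 : Type*} [RCLike 𝕜] {E : Type*} [NormedAddCommGroup E] [InnerProductSpace 𝕜 E]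

/-- **For `m ∈ U` with `‖m‖² = re⟨m, v⟩`: `‖m‖² ≤ ‖P_U v‖²`** (`⟨m, v⟩ = ⟨m, P_U v⟩` and Cauchy–Schwarz). [folklore] -/
theorem norm_sq_le_norm_sq_starProjection_of_mem (U : Submodule 𝕜 E) [U.HasOrthogonalProjection] {m : E} (hm : m ∈ U) (v : E)
    (h : ‖m‖ ^ 2 = RCLike.re ⟪m, v⟫_𝕜) : ‖m‖ ^ 2 ≤ ‖U.starProjection v‖ ^ 2 := by
  have h1 : ⟪m, v⟫_𝕜 = ⟪m, U.starProjection v⟫_𝕜 := by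
    rw [← U.inner_starProjection_left_eq_right, Submodule.starProjection_eq_self_iff.mpr hm]
  have h2 : ‖m‖ ^ 2 ≤ ‖m‖ * ‖U.starProjection v‖ := by
    rw [h, h1]
    exact (RCLike.re_le_norm _).trans (norm_inner_le_norm _ _)
  by_cases hm0 : m = 0
  · rw [hm0, norm_zero, zero_pow two_ne_zero]
    positivity
  · have hpos : 0 < ‖m‖ := norm_pos_iff.mpr hm0
    have h3 : ‖m‖ ≤ ‖U.starProjection v‖ := by
      rw [pow_two] at h2
      exact le_of_mul_le_mul_left h2 hpos
    exact pow_le_pow_left₀ (norm_nonneg _) h3 2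

end Abstract

/-! ## §1 Real-linear maps of the coefficients commute with the flat site operators -/

section Natural

variable {P : Params} {j : ℕ} {V W : Type*} [AddCommGroup V] [Module ℝ V] [AddCommGroup W] [Module ℝ W]

/-- An `ℝ`-linear map of the coefficients commutes with the lattice Laplacian. [cite: Balaban1984PropagatorsI, (1.21) p.21] -/
theorem map_laplace (φ : V →ₗ[ℝ] W) (c : ℝ) (f : SiteField P j V) (x : Site P j) :
    φ (laplace c f x) = laplace c (fun y => φ (f y)) x := by
  simp only [LatticeFieldCalculus.laplace, map_sum, map_smul, map_add, map_sub]

/-- An `ℝ`-linear map of the coefficients commutes with the lattice gradient. [cite: Balaban1984PropagatorsI, (1.4) p.18] -/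
theorem map_grad (φ : V →ₗ[ℝ] W) (c : ℝ) (f : SiteField P j V) (b : PBond P j) :
    φ (grad c f b) = grad c (fun y => φ (f y)) b := by
  simp only [LatticeFieldCalculus.grad, map_smul, map_sub]

/-- An `ℝ`-linear map of the coefficients commutes with the site block average `Q′`. [cite: Balaban1984PropagatorsI, (1.13) p.19] -/
theorem map_siteAvg (φ : V →ₗ[ℝ] W) (f : SiteField P j V) (y : Site P (j + 1)) :
    φ (siteAvg f y) = siteAvg (fun x => φ (f x)) y := by
  simp only [LatticeFieldCalculus.siteAvg, map_smul, map_sum]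

/-- An `ℝ`-linear map of the coefficients commutes with the iterated site average `Q′_k`. [cite: Balaban1984PropagatorsI, (1.20) p.20] -/
theorem map_siteAvgIter (φ : V →ₗ[ℝ] W) : ∀ (k : ℕ) (f : SiteField P 0 V) (y : Site P k),
    φ (siteAvgIter k f y) = siteAvgIter k (fun x => φ (f x)) y
  | 0, _, _ => rfl
  | k + 1, f, y => by
    show φ (siteAvg (siteAvgIter k f) y) = siteAvg (siteAvgIter k (fun x => φ (f x))) y
    rw [map_siteAvg]
    exact congrArg (fun g : SiteField P k W => siteAvg g y) (funext (map_siteAvgIter φ k f))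

/-- Entrywise real part of the lattice Laplacian of a matrix field. [cite: Balaban1984PropagatorsI, (1.21) p.21] -/
theorem laplace_entry_re {N : ℕ} (c : ℝ) (f : SiteField P j (Matrix (Fin N) (Fin N) ℂ)) (x : Site P j) (i i' : Fin N) :
    (laplace c f x i i').re = laplace c (fun y => (f y i i').re) x :=
  map_laplace (Complex.reLm ∘ₗ Matrix.entryLinearMap ℝ ℂ i i') c f x

/-- Entrywise imaginary part of the lattice Laplacian of a matrix field. [cite: Balaban1984PropagatorsI, (1.21) p.21] -/
theorem laplace_entry_im {N : ℕ} (c : ℝ) (f : SiteField P j (Matrix (Fin N) (Fin N) ℂ)) (x : Site P j) (i i' : Fin N) :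
    (laplace c f x i i').im = laplace c (fun y => (f y i i').im) x :=
  map_laplace (Complex.imLm ∘ₗ Matrix.entryLinearMap ℝ ℂ i i') c f x

/-- Entrywise real part of the iterated site average of a matrix field. [cite: Balaban1984PropagatorsI, (1.20) p.20] -/
theorem siteAvgIter_entry_re {N : ℕ} (k : ℕ) (f : SiteField P 0 (Matrix (Fin N) (Fin N) ℂ)) (y : Site P k) (i i' : Fin N) :
    (siteAvgIter k f y i i').re = siteAvgIter k (fun x => (f x i i').re) y :=
  map_siteAvgIter (Complex.reLm ∘ₗ Matrix.entryLinearMap ℝ ℂ i i') k f y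

/-- Entrywise imaginary part of the iterated site average of a matrix field. [cite: Balaban1984PropagatorsI, (1.20) p.20] -/
theorem siteAvgIter_entry_im {N : ℕ} (k : ℕ) (f : SiteField P 0 (Matrix (Fin N) (Fin N) ℂ)) (y : Site P k) (i i' : Fin N) :
    (siteAvgIter k f y i i').im = siteAvgIter k (fun x => (f x i i').im) y :=
  map_siteAvgIter (Complex.imLm ∘ₗ Matrix.entryLinearMap ℝ ℂ i i') k f y

/-- Entrywise real part of the divergence of a matrix bond field. [cite: Balaban1984PropagatorsI, (1.21) p.21] -/
theorem diverg_entry_re' {N : ℕ} (c : ℝ) (A : VecField P j (Matrix (Fin N) (Fin N) ℂ)) (x : Site P j) (i i' : Fin N) :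
    (diverg c A x i i').re = diverg c (fun b => (A b i i').re) x := by
  simp only [LatticeFieldCalculus.diverg, Complex.re_sum, Matrix.sum_apply, Matrix.smul_apply, Matrix.sub_apply, Complex.real_smul,
    Complex.mul_re, Complex.ofReal_re, Complex.ofReal_im, zero_mul, sub_zero, Complex.sub_re, smul_eq_mul]

/-- Entrywise imaginary part of the divergence of a matrix bond field. [cite: Balaban1984PropagatorsI, (1.21) p.21] -/
theorem diverg_entry_im' {N : ℕ} (c : ℝ) (A : VecField P j (Matrix (Fin N) (Fin N) ℂ)) (x : Site P j) (i i' : Fin N) :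
    (diverg c A x i i').im = diverg c (fun b => (A b i i').im) x := by
  simp only [LatticeFieldCalculus.diverg, Complex.im_sum, Matrix.sum_apply, Matrix.smul_apply, Matrix.sub_apply, Complex.real_smul,
    Complex.mul_im, Complex.ofReal_re, Complex.ofReal_im, zero_mul, add_zero, Complex.sub_im, smul_eq_mul]

end Natural

/-! ## §2 The flat readings at `U₀ = 1` of the member's first-order letters -/

section Flat

variable (F : T3Family) (n K : ℕ) (c₀ : ℝ) [Fact (0 < c₀)]

/-- **(3.3) AT THE TRIVIAL BACKGROUND IS THE FLAT GRADIENT**: `(toL2)⁻¹ (D_1 (toL2S λ)) = ∂λ` with lattice factor `η⁻¹`.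
[cite: Balaban1985BackgroundPropagators, (3.3) p.391; Balaban1984PropagatorsI, (1.4) p.18] -/
theorem DL2_one_eq_grad (l : Site (F.P K) 0 → Matrix (Fin 2) (Fin 2) ℂ) :
    (toL2 F K c₀).symm (DL2 F n K c₀ 1 (toL2S F K c₀ l)) = grad (eta F n K)⁻¹ l := by
  funext b
  rw [DL2_toL2S_eq_covDerivFwdT, bgUnits_one, covDerivFwdT_one]
  rfl

/-- **(3.8) AT THE TRIVIAL BACKGROUND IS THE FLAT DIVERGENCE**: `(toL2S)⁻¹ (D*_1 (toL2 X)) = ∂*X` with lattice factor `η⁻¹`.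
[cite: Balaban1985BackgroundPropagators, (3.8) p.392; Balaban1984PropagatorsI, (1.21) p.21] -/
theorem DstarL2_one_eq_diverg (X : PBond (F.P K) 0 → Matrix (Fin 2) (Fin 2) ℂ) :
    (toL2S F K c₀).symm (DstarL2 F n K c₀ 1 (toL2 F K c₀ X)) = diverg (eta F n K)⁻¹ X := by
  funext x
  rw [DstarL2_toL2_eq_covDivFormT, bgUnits_one, covDivFormT_one]

/-- **(3.23) AT THE TRIVIAL BACKGROUND IS THE FLAT LAPLACIAN**: `(toL2S)⁻¹ (Δ^η_1 (toL2S λ)) = Δλ` with lattice factor `η⁻¹`.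
[cite: Balaban1985BackgroundPropagators, (3.23) p.394; Balaban1984PropagatorsI, (1.21) p.21] -/
theorem covLapSite_one_eq_laplace (l : Site (F.P K) 0 → Matrix (Fin 2) (Fin 2) ℂ) :
    (toL2S F K c₀).symm (covLapSite F n K c₀ 1 (toL2S F K c₀ l)) = laplace (eta F n K)⁻¹ l := by
  rw [covLapSite, LinearMap.comp_apply, ← (toL2 F K c₀).apply_symm_apply (DL2 F n K c₀ 1 (toL2S F K c₀ l)), DL2_one_eq_grad,
    DstarL2_one_eq_diverg, LatticeFieldCalculus.diverg_grad]

end Flat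

/-! ## §3 The `L²` bookkeeping of the gauge parameters, entry by entry -/

section L2

variable (F : T3Family) (K : ℕ) (c₀ : ℝ) [Fact (0 < c₀)]

/-- **THE REAL PART OF THE WEIGHTED `L²` PAIRING OF TWO GAUGE PARAMETERS**, entry by entry: `re⟨λ, λ′⟩ = c₀ · Σ_x Σ_{ii′} (Re·Re + Im·Im)`.
[cite: Balaban1985BackgroundPropagators, (3.11) p.392] -/
theorem re_inner_toL2S (l l' : Site (F.P K) 0 → Matrix (Fin 2) (Fin 2) ℂ) :
    RCLike.re ⟪toL2S F K c₀ l, toL2S F K c₀ l'⟫_ℂ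
      = c₀ * ∑ x : Site (F.P K) 0, ∑ i : Fin 2, ∑ i' : Fin 2, ((l x i i').re * (l' x i i').re + (l x i i').im * (l' x i i').im) := by
  rw [WL2.inner_def, ← (siteEquiv F K).sum_comp, Finset.mul_sum, map_sum]
  refine Finset.sum_congr rfl fun x _ => ?_
  rw [toL2S_apply, toL2S_apply, Equiv.symm_apply_apply, PiLp.inner_apply, Fintype.sum_prod_type, Finset.mul_sum, Finset.mul_sum, map_sum]
  refine Finset.sum_congr rfl fun i _ => ?_
  rw [Finset.mul_sum, Finset.mul_sum, map_sum]
  refine Finset.sum_congr rfl fun i' _ => ?_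
  simp only [frobEquiv_symm_apply_apply, RCLike.inner_apply, RCLike.mul_re, RCLike.mul_im, RCLike.conj_re, RCLike.conj_im, RCLike.re_to_complex,
    RCLike.im_to_complex, Complex.coe_algebraMap, Complex.ofReal_re, Complex.ofReal_im]
  ring

end L2

/-! ## §4 ★★ THE PROJECTOR SEAM: `R_S(1)` dominates lit-balaban's one-level `R` entry by entry -/

section Seam

variable (F : T3Family) (n K : ℕ) (h : n ≤ K) (c₀ cB : ℝ) [Fact (0 < c₀)]

/-- The member's spacing: `η⁻¹ = L^{K−n}`. [cite: Balaban1985UV3, (1)-(3) p.256] -/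
theorem inv_eta_eq : (eta F n K)⁻¹ = (F.L : ℝ) ^ (K - n) := by
  rw [show eta F n K = ((F.L : ℝ)⁻¹) ^ (K - n) from rfl, inv_pow, inv_inv]

/-- For a real site function `f`: `⟨Rf, f⟩ = ‖Rf‖²` (`R` an orthogonal projection). [cite: Balaban1984PropagatorsII, (2.12) p.225] -/
theorem inner_RE_self {P : Params} (D : B6SectADomainsV1.Domains P) (c : ℝ) (f : ScalarSpace P) : ⟪RE D c f, f⟫_ℝ = ‖RE D c f‖ ^ 2 := by
  rw [← real_inner_self_eq_norm_sq]
  conv_lhs => rw [← B6SectAOperatorsV1.RE_eq_self D c (B6SectAOperatorsV1.RE_mem D c f), B6SectAOperatorsV1.inner_RE_left]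

/-- ★★ **THE PROJECTOR SEAM (S4 of the (c3) flat certificate of RULING g28-№13's coercivity row).**  At the trivial background `U₀ = 1`, for every gauge parameter
`λ : Site (F.P K) 0 → M₂(ℂ)`:
`c₀ · Σ_{ii′} (‖R (Re λ_{ii′})‖² + ‖R (Im λ_{ii′})‖²) ≤ ‖R_S(1) (toL2S λ)‖²`,
where `R = RE (twoScale (K−n) _ ∅) (L^{K−n})` is lit-balaban's orthogonal projection onto `Δ N(Q′)` ([Balaban1984PropagatorsII] (2.10)–(2.12), `N(Q′) = {μ : Q′_{K−n}μ = 0}`, the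
letter of ✓`Prop7FlatCoercivityR.flat_coercive_R_T3`) and `R_S(1) = Prop7SectET3GaugeProjector.RS … 1` is the member's intrinsic projector onto `Δ^η_1 N_S(1)`,
`N_S(1) = ker (Q(1) ∘ D_1)` ([Balaban1985BackgroundPropagators] (3.21), ★★OWNER ACK 32 (q1)).  REASON: by (3.115) in the flat form ✓`B5Eq120IterProof.bondAvgIter_grad`
(`Q_k ∂ = ∂ Q′_k`) every `μ ∈ N(Q′)` read into any matrix entry lies in `N_S(1)`, so the entrywise vector `Σ_{ii′} (R Re λ_{ii′} + i·R Im λ_{ii′}) E_{ii′}` lies in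
`Δ^η_1 N_S(1)`; it pairs with `toL2S λ` like its own square; §0.  No estimate, no analysis: the one non-mechanical seam of px6 g5's LOCATE «(c3) A6-FLAT GUARD» (19200 evidence #58).
[cite: Balaban1985BackgroundPropagators, (3.21)–(3.23) p.394, (3.115) p.418; Balaban1984PropagatorsII, (2.10)–(2.12) p.225] -/
theorem mul_sum_norm_sq_RE_entries_le_norm_sq_RS_one (l : Site (F.P K) 0 → Matrix (Fin 2) (Fin 2) ℂ) :
    c₀ * ∑ i : Fin 2, ∑ i' : Fin 2,
        (‖RE (twoScale (K - n) (succ_le_T3 F n K) (∅ : Finset (Site (F.P K) (K - n + 1)))) ((F.L : ℝ) ^ (K - n))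
              (WithLp.toLp 2 fun x => (l x i i').re)‖ ^ 2
          + ‖RE (twoScale (K - n) (succ_le_T3 F n K) (∅ : Finset (Site (F.P K) (K - n + 1)))) ((F.L : ℝ) ^ (K - n))
              (WithLp.toLp 2 fun x => (l x i i').im)‖ ^ 2)
      ≤ ‖RS F n K h c₀ cB 1 (toL2S F K c₀ l)‖ ^ 2 := by
  have hc₀ : (0 : ℝ) < c₀ := Fact.out
  set D := twoScale (K - n) (succ_le_T3 F n K) (∅ : Finset (Site (F.P K) (K - n + 1))) with hD
  set s : ℝ := (F.L : ℝ) ^ (K - n) with hs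
  have hη : (eta F n K)⁻¹ = s := inv_eta_eq F n K
  have hKn : K - n ≤ (F.P K).m + (F.P K).K := Nat.le_of_succ_le (succ_le_T3 F n K)
  -- every vector of `Δ N(Q′)` is `Δμ` with `Q′μ = 0`
  have hex : ∀ f : ScalarSpace (F.P K), ∃ μ : ScalarSpace (F.P K), siteAvgIter (K - n) (WithLp.ofLp μ) = 0 ∧ RE D s f = lapE s μ := fun f => by
    obtain ⟨μ, hμ, hEq⟩ := RE_range D s f
    exact ⟨μ, (QpE_twoScale_empty_eq_zero_iff (succ_le_T3 F n K) μ).mp (LinearMap.mem_ker.mp hμ), hEq⟩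
  choose μf hμf hRμ using hex
  -- the real entry fields of `λ`
  set fr : Fin 2 → Fin 2 → ScalarSpace (F.P K) := fun i i' => WithLp.toLp 2 fun x => (l x i i').re with hfr
  set fi : Fin 2 → Fin 2 → ScalarSpace (F.P K) := fun i i' => WithLp.toLp 2 fun x => (l x i i').im with hfi
  -- the gauge parameter `Λ ∈ N_S(1)` and the vector `m = Δ^η_1 Λ`
  set Lam : Site (F.P K) 0 → Matrix (Fin 2) (Fin 2) ℂ := fun x => Matrix.of fun i i' =>
      ((μf (fr i i') x : ℝ) : ℂ) + ((μf (fi i i') x : ℝ) : ℂ) * Complex.I with hLam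
  set mf : Site (F.P K) 0 → Matrix (Fin 2) (Fin 2) ℂ := fun x => Matrix.of fun i i' =>
      ((RE D s (fr i i') x : ℝ) : ℂ) + ((RE D s (fi i i') x : ℝ) : ℂ) * Complex.I with hmf
  have hLam_re : ∀ x i i', (Lam x i i').re = μf (fr i i') x := fun x i i' => by simp [hLam]
  have hLam_im : ∀ x i i', (Lam x i i').im = μf (fi i i') x := fun x i i' => by simp [hLam]
  have hmf_re : ∀ x i i', (mf x i i').re = RE D s (fr i i') x := fun x i i' => by simp [hmf]
  have hmf_im : ∀ x i i', (mf x i i').im = RE D s (fi i i') x := fun x i i' => by simp [hmf]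
  -- Claim 1: `Δ^η_1 (toL2S Λ) = toL2S m`
  have h1 : covLapSite F n K c₀ 1 (toL2S F K c₀ Lam) = toL2S F K c₀ mf := by
    apply (toL2S F K c₀).symm.injective
    rw [covLapSite_one_eq_laplace, LinearEquiv.symm_apply_apply, hη]
    funext x
    ext i i'
    apply Complex.ext
    · rw [laplace_entry_re, hmf_re, hRμ, lapE_apply]
      exact congrArg (fun g : SiteField (F.P K) 0 ℝ => laplace s g x) (funext fun y => hLam_re y i i')
    · rw [laplace_entry_im, hmf_im, hRμ, lapE_apply]
      exact congrArg (fun g : SiteField (F.P K) 0 ℝ => laplace s g x) (funext fun y => hLam_im y i i')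
  -- Claim 2: `toL2S Λ ∈ N_S(1) = ker (Q(1) ∘ D_1)` — (3.115) `Q_k ∂ = ∂ Q′_k` entrywise
  have hsite : siteAvgIter (K - n) Lam = 0 := by
    funext y
    ext i i'
    apply Complex.ext
    · rw [siteAvgIter_entry_re, Pi.zero_apply, Matrix.zero_apply, Complex.zero_re]
      have := congrFun (hμf (fr i i')) y
      rw [Pi.zero_apply] at this
      rw [← this]
      exact congrArg (fun g : SiteField (F.P K) 0 ℝ => siteAvgIter (K - n) g y) (funext fun x => hLam_re x i i')
    · rw [siteAvgIter_entry_im, Pi.zero_apply, Matrix.zero_apply, Complex.zero_im]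
      have := congrFun (hμf (fi i i')) y
      rw [Pi.zero_apply] at this
      rw [← this]
      exact congrArg (fun g : SiteField (F.P K) 0 ℝ => siteAvgIter (K - n) g y) (funext fun x => hLam_im x i i')
  have h2 : toL2S F K c₀ Lam ∈ LinearMap.ker (QDS F n K h c₀ cB 1) := by
    rw [LinearMap.mem_ker, QDS_apply, ← (toL2 F K c₀).apply_symm_apply (DL2 F n K c₀ 1 (toL2S F K c₀ Lam)), DL2_one_eq_grad, QL2_toL2, hη]
    have hQ : QTwS F n K h 1 (grad s Lam) = 0 := by
      funext c
      rw [QTwS_one_apply, B5Eq120IterProof.bondAvgIter_grad (K - n) hKn s Lam, hsite, Pi.zero_apply]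
      simp [LatticeFieldCalculus.grad]
    rw [hQ, map_zero]
  -- so `toL2S m ∈ Δ^η_1 N_S(1)`, the range of `R_S(1)`
  have hmem : toL2S F K c₀ mf ∈ (LinearMap.ker (QDS F n K h c₀ cB 1)).map (covLapSite F n K c₀ 1) :=
    Submodule.mem_map.mpr ⟨toL2S F K c₀ Lam, h2, h1⟩
  -- Claim 3: `‖m‖² = c₀·Σ(‖R Re λ‖² + ‖R Im λ‖²) = re⟨m, toL2S λ⟩`
  have hsq : ∀ f : ScalarSpace (F.P K), ‖RE D s f‖ ^ 2 = ∑ x, (RE D s f x) ^ 2 := fun f => EuclideanSpace.real_norm_sq_eq _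
  have hinn : ∀ f : ScalarSpace (F.P K), ‖RE D s f‖ ^ 2 = ∑ x, RE D s f x * f x := fun f => by
    rw [← inner_RE_self, B6SectAOperatorsV1.inner_eq_sum]
  have hnorm : ‖toL2S F K c₀ mf‖ ^ 2 = c₀ * ∑ i : Fin 2, ∑ i' : Fin 2, (‖RE D s (fr i i')‖ ^ 2 + ‖RE D s (fi i i')‖ ^ 2) := by
    rw [Prop7LaplaceAFlatLetters.norm_sq_toL2S]
    congr 1
    rw [Finset.sum_comm]
    refine Finset.sum_congr rfl fun i _ => ?_
    rw [Finset.sum_comm]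
    refine Finset.sum_congr rfl fun i' _ => ?_
    rw [hsq, hsq, ← Finset.sum_add_distrib]
    refine Finset.sum_congr rfl fun x _ => ?_
    rw [Complex.sq_norm, Complex.normSq_apply, hmf_re, hmf_im]
    ring
  have hre : RCLike.re ⟪toL2S F K c₀ mf, toL2S F K c₀ l⟫_ℂ = c₀ * ∑ i : Fin 2, ∑ i' : Fin 2, (‖RE D s (fr i i')‖ ^ 2 + ‖RE D s (fi i i')‖ ^ 2) := by
    rw [re_inner_toL2S]
    congr 1
    rw [Finset.sum_comm]
    refine Finset.sum_congr rfl fun i _ => ?_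
    rw [Finset.sum_comm]
    refine Finset.sum_congr rfl fun i' _ => ?_
    rw [hinn, hinn, ← Finset.sum_add_distrib]
    refine Finset.sum_congr rfl fun x _ => ?_
    rw [hmf_re, hmf_im]
  -- §0 at the range of `R_S(1)`
  haveI : CompleteSpace ↥((LinearMap.ker (QDS F n K h c₀ cB 1)).map (covLapSite F n K c₀ 1)) := FiniteDimensional.complete ℂ _
  have hP : RS F n K h c₀ cB 1 (toL2S F K c₀ l) = ((LinearMap.ker (QDS F n K h c₀ cB 1)).map (covLapSite F n K c₀ 1)).starProjection (toL2S F K c₀ l) := by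
    rw [RS_eq_projR]
    rfl
  rw [← hnorm, hP]
  exact norm_sq_le_norm_sq_starProjection_of_mem _ hmem _ (by rw [hnorm, hre])

/-- ★★ **THE SAME AT THE DIVERGENCE OF A FINE FIELD — THE ROW THE (c3) ASSEMBLY CONSUMES**: for every `X : PBond (F.P K) 0 → M₂(ℂ)`,
`c₀ · Σ_{ii′} (‖R ∂*(Re X_{ii′})‖² + ‖R ∂*(Im X_{ii′})‖²) ≤ ‖R_S(1) (D*_1 (toL2 X))‖²` with lit-balaban's `∂* = dsE (L^{K−n})` — the `‖R∂*A‖²` term of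
✓`Prop7FlatCoercivityR.flat_coercive_R_T3` on each of the eight real components, dominated by the `D R_S D*` term of the member's `Δ_a(1)` (`laplaceA … 1`, whose middle term pairs to
`‖R_S(1)(D*_1 y)‖²`). [cite: Balaban1985BackgroundPropagators, (3.8) p.392, (3.21)–(3.26) pp.394–395; Balaban1984PropagatorsI, Prop. 1.1 (1.90) p.33] -/
theorem mul_sum_norm_sq_RE_dsE_entries_le_norm_sq_RS_one_DstarL2 (X : PBond (F.P K) 0 → Matrix (Fin 2) (Fin 2) ℂ) :
    c₀ * ∑ i : Fin 2, ∑ i' : Fin 2,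
        (‖RE (twoScale (K - n) (succ_le_T3 F n K) (∅ : Finset (Site (F.P K) (K - n + 1)))) ((F.L : ℝ) ^ (K - n))
              (dsE ((F.L : ℝ) ^ (K - n)) (WithLp.toLp 2 fun b => (X b i i').re))‖ ^ 2
          + ‖RE (twoScale (K - n) (succ_le_T3 F n K) (∅ : Finset (Site (F.P K) (K - n + 1)))) ((F.L : ℝ) ^ (K - n))
              (dsE ((F.L : ℝ) ^ (K - n)) (WithLp.toLp 2 fun b => (X b i i').im))‖ ^ 2)
      ≤ ‖RS F n K h c₀ cB 1 (DstarL2 F n K c₀ 1 (toL2 F K c₀ X))‖ ^ 2 := by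
  have hX : DstarL2 F n K c₀ 1 (toL2 F K c₀ X) = toL2S F K c₀ (diverg ((F.L : ℝ) ^ (K - n)) X) := by
    rw [← inv_eta_eq F n K, ← DstarL2_one_eq_diverg F n K c₀ X, LinearEquiv.apply_symm_apply]
  have hre : ∀ i i' : Fin 2, dsE ((F.L : ℝ) ^ (K - n)) (WithLp.toLp 2 fun b => (X b i i').re)
      = WithLp.toLp 2 (fun x => (diverg ((F.L : ℝ) ^ (K - n)) X x i i').re) := fun i i' => by
    ext x
    change diverg ((F.L : ℝ) ^ (K - n)) (fun b => (X b i i').re) x = (diverg ((F.L : ℝ) ^ (K - n)) X x i i').re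
    rw [diverg_entry_re']
  have him : ∀ i i' : Fin 2, dsE ((F.L : ℝ) ^ (K - n)) (WithLp.toLp 2 fun b => (X b i i').im)
      = WithLp.toLp 2 (fun x => (diverg ((F.L : ℝ) ^ (K - n)) X x i i').im) := fun i i' => by
    ext x
    change diverg ((F.L : ℝ) ^ (K - n)) (fun b => (X b i i').im) x = (diverg ((F.L : ℝ) ^ (K - n)) X x i i').im
    rw [diverg_entry_im']
  simp only [hre, him, hX]
  exact mul_sum_norm_sq_RE_entries_le_norm_sq_RS_one F n K h c₀ cB _

end Seam

end Summit.QuantumFields.YangMills.Theorems.Prop7FlatProjectorSeam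

end
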